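import Summits.BirchSwinnertonDyer.BirchSwinnertonDyer.Theorems.EdixhovenFibreFiveSevenNonEisensteinWitness
import Literature.NumberTheory.EllipticCurves.FrobeniusManinProofs
import HarnessLib

/-!
# The TRANSFER WITNESS from a Galois element: Chebotarev in `ℚ(E[p], μ_{4p})` and Manin's relation
# `φ² − a_ℓ φ + ℓ = 0` on `E[p]` (route `EdixhovenFibreFiveSeven`, crux TDS57, `--supports`; ROAD A′ part 5)

Cell `pub/bsd-wall` (D-0145 line `route-BirchSwinnertonDyer-EdixhovenFibreFiveSeven`), seat `bsd-line-edix-p3`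
(prover). THEOREMS ONLY (no definition, no named fact, no `sorry`); route-free. BSD is not proved by this file.

The Ihara-free L-TWIST chain (`LTwistTransfer.twistDegreeStepFiveSeven_of_kato_of_transferWitness`, p594464)
needs, per curve `V₀` (additive at `p ∈ {5,7}`, `E[p]` irreducible), ONE auxiliary prime `q ∤ 2pN(V₀)` with
`q*` a non-residue mod `p` and `p ∤ (q − 1)((q + 1)² − a_q²)`. This file reduces that arithmetic statement to a
GALOIS-SIDE one (to be discharged by finite group theory on the image of `ρ̄_{E,p}`): if some `σ ∈ Γ_ℚ` has
`χ_{4p}(σ)` in a good class (every `ℓ ≡ χ_{4p}(σ) (mod 4p)` has `ℓ*` a non-residue and `ℓ ≢ 1 (mod p)`) and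
`ρ̄(σ)` has NO eigenvalue `±1` on `E[p]`, then such a prime `q` exists:

* §1 `frobenius_relation_torsion` — **Manin's relation for ANY arithmetic Frobenius**: for `W/ℚ` globally
  minimal, `ℓ ≠ p` good, `𝔓 ∣ ℓ`, `φ` an arithmetic Frobenius at `𝔓` and `P ∈ E[p]`:
  `φ²P − a_ℓ φP + ℓP = O` (Silverman V.2.3.1 on `Ẽ_ℓ`, transported along the injective reduction map VII.3.1(b),
  tree `exists_reduceTorsionHom`; independence of `𝔓`/`φ` by conjugacy of Frobenii and triviality of inertia on
  `E[p]`, tree `exists_smul_eq_of_mem_primesAbove_holds`, `smul_eq_of_mem_inertia_of_nsmul_eq_zero`).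
* §2 `transferWitness_of_galois` — Chebotarev (tree `exists_isArithFrobAt_mul_inv_mem_not_mem`, PROVED) for
  `ker ρ̄_{E,p} ∩ Gal(ℚ̄/ℚ(μ_{4p}))` gives `ℓ` with `φ ≡ σ` on `E[p]` and `ℓ ≡ χ_{4p}(σ) (mod 4p)`
  (`modNCyclotomicCharacter_eq_residueCard_of_isArithFrobAt`); `p ∣ #Ẽ(𝔽_ℓ)` would give `φ` a fixed point
  (`exists_frobenius_smul_eq_of_dvd_reductionPointCount_holds`); `p ∣ ℓ + 1 + a_ℓ` and §1 give
  `(φ + 1)(φ + ℓ) = 0` on `E[p]`, so (no eigenvalue `−1`) `φ = −ℓ` on `E[p]`, `det = ℓ² ≠ ℓ = χ̄_p(φ)`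
  (Weil pairing, tree `det_eq_modPCyclotomicCharacterZMod_of_exists_weilPairing`) — contradiction.

References: [SilvermanAEC2009] V.2.3.1, VII.3.1(b), VII.4.1; [TateGCFT1967] §2.4; [SilvermanCSS1997] II §7–8.
-/

set_option autoImplicit false
-- the Theorems directory repeats the summit name (sibling precedent `SignedBaseChangeAssembly.lean`)
set_option linter.dupNamespace false

noncomputable section

open scoped Classical

open WeierstrassCurve NumberField IsDedekindDomain IsDedekindDomain.HeightOneSpectrum Field
  Literature.NumberTheory.EllipticCurves Literature.NumberTheory.GaloisRepresentations
  Literature.NumberTheory.EllipticCurves.Rank1Residual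

namespace Summit.BirchSwinnertonDyer.BirchSwinnertonDyer.Theorems.LTwistTransfer

/-! ### §1 Manin's relation `φ² − a_ℓ φ + ℓ = 0` on `E[p]` for any arithmetic Frobenius `φ` at `𝔓 ∣ ℓ` -/

/-- **Manin's relation for SOME Frobenius** (the construction of the tree's
`KolyvaginPrimeTorsionFixingOfIndex`): for `W/ℚ` globally minimal with good reduction at the place `v ∣ ℓ`,
`ℓ ≠ p`, there are a prime `𝔓₀ ∣ v` of `ℤ̄` and an arithmetic Frobenius `h` at `𝔓₀` with
`h²P − a_ℓ hP + ℓP = O` for every `P ∈ E[p]` (Silverman V.2.3.1 on the reduction, pulled back along the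
injective reduction map on `p`-primary torsion, VII.3.1(b)). [cite: SilvermanAEC2009, V.2.3.1 and VII.3.1(b)] -/
theorem exists_isArithFrobAt_relation (W : WeierstrassCurve ℚ) [W.IsElliptic] [W.IsGloballyMinimal]
    {p ℓ : ℕ} [Fact p.Prime] [Fact ℓ.Prime] (hℓp : ℓ ≠ p)
    {v : HeightOneSpectrum (𝓞 ℚ)} (hv : (ℓ : 𝓞 ℚ) ∈ v.asIdeal) (hgood : W.HasGoodReductionAt v) :
    ∃ 𝔓₀ ∈ v.primesAbove, ∃ h : absoluteGaloisGroup ℚ, IsArithFrobAt (𝓞 ℚ) h 𝔓₀ ∧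
      ∀ P : geomPoints W, p • P = 0 →
        h • (h • P) - W.frobeniusTrace ℓ • (h • P) + (ℓ : ℤ) • P = 0 := by
  have hp : p.Prime := Fact.out
  have hℓ : ℓ.Prime := Fact.out
  have hvℓ : (Rat.HeightOneSpectrum.primesEquiv v : ℕ) = ℓ := primesEquiv_eq_of_natCast_mem hℓ hv
  have hpv : (p : 𝓞 ℚ) ∉ v.asIdeal := fun h ↦
    hℓp (hvℓ.symm.trans (primesEquiv_eq_of_natCast_mem hp h))
  set kv := IsLocalRing.ResidueField (v.adicCompletionIntegers ℚ) with hkv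
  letI : Fintype kv := Fintype.ofFinite kv
  set Wt : WeierstrassCurve kv := W.reductionAt v with hWt
  haveI : Wt.IsElliptic := isElliptic_reductionAt hgood
  have hcardk : Fintype.card kv = ℓ := by
    rw [← Nat.card_eq_fintype_card, natCard_residueField_adicCompletionIntegers v, hvℓ]
  have hcardWt : Nat.card Wt.toAffine.Point = W.reductionPointCount ℓ := by
    rw [← hvℓ]
    exact natCard_point_reduction_minimal_baseChange v W
  have htr : HasseManin.tr Wt = W.frobeniusTrace ℓ := by
    rw [HasseManin.tr, hcardk, hcardWt, frobeniusTrace]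
  obtain ⟨𝔐, h𝔐⟩ := v.localPrimesAbove_nonempty
  let ι : AlgebraicClosure ℚ →ₐ[ℚ] AlgebraicClosure (v.adicCompletion ℚ) :=
    closureEmb (K := ℚ) (v.adicCompletion ℚ)
  obtain ⟨σL, hσL⟩ := v.exists_isArithFrobAt_localAbsIntegers h𝔐
  obtain ⟨φk, hφk⟩ := exists_frobenius_absoluteGaloisGroup kv
  obtain ⟨f, hf, hfσ⟩ := exists_reduceTorsionHom hpv hgood h𝔐 ι hσL hφk
  set σ₀ : absoluteGaloisGroup ℚ := resGalOfEmb ι σL with hσ₀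
  refine ⟨v.primeBelow ι 𝔐, HeightOneSpectrum.primeBelow_mem_primesAbove h𝔐, σ₀,
    isArithFrobAt_resGalOfEmb h𝔐 ι hσL, fun P hpP ↦ ?_⟩
  set P' : geomPrimaryTorsion W p := ⟨P, 1, by rw [pow_one]; exact hpP⟩ with hP'def
  have hP' : (P' : geomPoints W) = P := rfl
  have hmanin := Wt.frobenius_sq_sub_trace_smul_add_card_smul hφk (f P')
  rw [htr, hcardk, ← hfσ, ← hfσ, ← map_zsmul, ← map_zsmul, ← map_sub, ← map_add,
    ← f.map_zero] at hmanin
  have hrel : σ₀ • (σ₀ • P') - W.frobeniusTrace ℓ • (σ₀ • P') + (ℓ : ℤ) • P' = 0 := hf hmanin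
  have h := congrArg Subtype.val hrel
  simp only [AddSubgroupClass.coe_sub, AddMemClass.coe_add, primaryComponent.coe_smul,
    ZeroMemClass.coe_zero, hP'] at h
  exact h

/-- **Manin's relation for EVERY arithmetic Frobenius on `E[p]`.** For `W/ℚ` globally minimal, primes
`ℓ ≠ p` with good reduction at `ℓ`, every prime `𝔓` of `ℤ̄` above `ℓ` and every arithmetic Frobenius `φ` at
`𝔓`: `φ²P − a_ℓ φP + ℓP = O` for all `P ∈ E[p]`. From `exists_isArithFrobAt_relation` by conjugating
(`exists_smul_eq_of_mem_primesAbove_holds`, `IsArithFrobAt.conj`) and the triviality of inertia on `E[p]` at a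
good `ℓ ≠ p` (`smul_eq_of_mem_inertia_of_nsmul_eq_zero`, Silverman VII.4.1).
[cite: SilvermanAEC2009, V.2.3.1, VII.3.1(b) and VII.4.1] -/
theorem frobenius_relation_torsion (W : WeierstrassCurve ℚ) [W.IsElliptic] [W.IsGloballyMinimal]
    {p ℓ : ℕ} [Fact p.Prime] [Fact ℓ.Prime] (hℓp : ℓ ≠ p) (hgoodℓ : W.HasGoodReductionAtPrime ℓ)
    {v : HeightOneSpectrum (𝓞 ℚ)} (hv : (ℓ : 𝓞 ℚ) ∈ v.asIdeal)
    {𝔓 : Ideal (absIntegers (𝓞 ℚ) ℚ)} (h𝔓 : 𝔓 ∈ v.primesAbove)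
    {φ : absoluteGaloisGroup ℚ} (hφ : IsArithFrobAt (𝓞 ℚ) φ 𝔓) (P : geomPoints W) (hpP : p • P = 0) :
    φ • (φ • P) - W.frobeniusTrace ℓ • (φ • P) + (ℓ : ℤ) • P = 0 := by
  have hp : p.Prime := Fact.out
  have hℓ : ℓ.Prime := Fact.out
  have hvℓ : (Rat.HeightOneSpectrum.primesEquiv v : ℕ) = ℓ := primesEquiv_eq_of_natCast_mem hℓ hv
  have hgood : W.HasGoodReductionAt v :=
    (hasGoodReductionAtPrime_primesEquiv_iff_holds W v ℓ hvℓ).mp hgoodℓ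
  have hpv : (p : 𝓞 ℚ) ∉ v.asIdeal := fun h ↦
    hℓp (hvℓ.symm.trans (primesEquiv_eq_of_natCast_mem hp h))
  obtain ⟨𝔓₀, h𝔓₀, σ₀, hσ₀F, hrel⟩ := exists_isArithFrobAt_relation W (p := p) hℓp hv hgood
  -- transport from `(𝔓₀, σ₀)` to `(𝔓, φ)`
  obtain ⟨τ, hτ⟩ := exists_smul_eq_of_mem_primesAbove_holds h𝔓₀ h𝔓
  set γ : absoluteGaloisGroup ℚ := τ * σ₀ * τ⁻¹ with hγdef
  have hγ : IsArithFrobAt (𝓞 ℚ) γ 𝔓 := hτ ▸ hσ₀F.conj τ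
  have hI : φ * γ⁻¹ ∈ 𝔓.inertia (absoluteGaloisGroup ℚ) := hφ.mul_inv_mem_inertia hγ
  -- `φ` and `γ` agree on `p`-torsion points
  have hagree : ∀ X : geomPoints W, p • X = 0 → φ • X = γ • X := by
    intro X hX
    have hγX : p • (γ • X) = 0 := by rw [← smul_comm γ p X, hX, smul_zero]
    have h1 : φ • X = (φ * γ⁻¹) • (γ • X) := by rw [← mul_smul, inv_mul_cancel_right]
    rw [h1]
    exact W.smul_eq_of_mem_inertia_of_nsmul_eq_zero hgood hpv h𝔓 hI hγX
  have hpγP : p • (γ • P) = 0 := by rw [← smul_comm γ p P, hpP, smul_zero]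
  -- the relation for `γ = τ σ₀ τ⁻¹` from the one for `σ₀` at `τ⁻¹ P`
  have hP₀ : p • (τ⁻¹ • P) = 0 := by rw [← smul_comm τ⁻¹ p P, hpP, smul_zero]
  have h0 := hrel (τ⁻¹ • P) hP₀
  have hγP : γ • P = τ • (σ₀ • (τ⁻¹ • P)) := by rw [hγdef, mul_smul, mul_smul]
  have hγγP : γ • (γ • P) = τ • (σ₀ • (σ₀ • (τ⁻¹ • P))) := by
    rw [hγP, hγdef, mul_smul, mul_smul, inv_smul_smul]
  rw [hagree P hpP, hagree (γ • P) hpγP, hγγP, hγP]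
  have h1 : τ • (σ₀ • (σ₀ • (τ⁻¹ • P)) - W.frobeniusTrace ℓ • (σ₀ • (τ⁻¹ • P)) + (ℓ : ℤ) • (τ⁻¹ • P)) =
      τ • (0 : geomPoints W) := by rw [h0]
  rw [smul_zero, smul_add, smul_sub, smul_comm τ (W.frobeniusTrace ℓ), smul_comm τ (ℓ : ℤ),
    smul_inv_smul] at h1
  exact h1

/-! ### §2 From a Galois element to the auxiliary prime -/

/-- `E[p]` has a non-zero point (`#E[p] = p²`). [cite: SilvermanAEC2009, Cor. III.6.4(b)] -/
theorem exists_geomTorsion_ne_zero (W : WeierstrassCurve ℚ) [W.IsElliptic] (p : ℕ) [Fact p.Prime] :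
    ∃ P : geomTorsion W p, P ≠ 0 := by
  have hp : p.Prime := Fact.out
  have hA : Nat.card (geomTorsion W (p ^ 1 : ℕ)) = (p ^ 1) ^ 2 :=
    card_torsionPoints_eq_sq_holds W (AlgebraicClosure ℚ) (Nat.cast_ne_zero.mpr (pow_ne_zero 1 hp.ne_zero))
  rw [pow_one] at hA
  haveI : Finite (geomTorsion W p) := Nat.finite_of_card_ne_zero (by rw [hA]; exact pow_ne_zero _ hp.ne_zero)
  by_contra h
  push Not at h
  have h1 : Nat.card (geomTorsion W p) = 1 := by
    rw [Nat.card_eq_one_iff_exists]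
    exact ⟨0, fun P ↦ h P⟩
  rw [h1] at hA
  have : 1 < p ^ 2 := Nat.one_lt_pow two_ne_zero hp.one_lt
  omega

/-- **The auxiliary prime from a Galois element.** Let `W/ℚ` be globally minimal, `p` an odd prime, and
`σ ∈ Γ_ℚ` such that (i) every `ℓ ≡ χ_{4p}(σ) (mod 4p)` has `ℓ* = (−1)^{(ℓ−1)/2} ℓ` a non-residue mod `p` and
`ℓ ≢ 1 (mod p)`, and (ii) `ρ̄_{E,p}(σ)` has no eigenvalue `1` and no eigenvalue `−1`. Then there is a prime
`q ∤ 2 p N(W)` with `q*` a non-residue mod `p` and `p ∤ (q − 1)((q + 1)² − a_q(W)²)`: Chebotarev for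
`ker ρ̄ ∩ Gal(ℚ̄/ℚ(μ_{4p}))` (`exists_isArithFrobAt_mul_inv_mem_not_mem`), `χ_{4p}(Frob) = q`
(`modNCyclotomicCharacter_eq_residueCard_of_isArithFrobAt`), fixed points from `p ∣ #Ẽ(𝔽_q)`
(`exists_frobenius_smul_eq_of_dvd_reductionPointCount_holds`), and for `p ∣ q + 1 + a_q` Manin's relation
(`frobenius_relation_torsion`) forces `φ = −q` on `E[p]`, contradicting `det ρ̄(φ) = χ̄_p(φ) = q ≠ q²`
(Weil pairing, `det_eq_modPCyclotomicCharacterZMod_of_exists_weilPairing`).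
[cite: TateGCFT1967, §2.4 (Tchebotarev density theorem)] [cite: SilvermanAEC2009, V.2.3.1, VII.3.1(b)]
[cite: SilvermanCSS1997, Ch. II §7 Proposition and §8] -/
theorem exists_transferPrime_of_galois (W : WeierstrassCurve ℚ) [W.IsElliptic] [W.IsGloballyMinimal]
    (p : ℕ) [Fact p.Prime] {σ : absoluteGaloisGroup ℚ}
    (hσcl : ∀ ℓ : ℕ, ((ℓ : ZMod (4 * p)) = (modNCyclotomicCharacter ℚ (4 * p) σ : ZMod (4 * p))) →
        ¬ IsSquare ((((-1 : ℤ) ^ (ℓ / 2) * ℓ : ℤ)) : ZMod p) ∧ ¬ (p : ℤ) ∣ (ℓ : ℤ) - 1)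
    (hσ1 : ∀ P : geomTorsion W p, σ • P = P → P = 0)
    (hσ2 : ∀ P : geomTorsion W p, σ • P = -P → P = 0) :
    ∃ q : ℕ, q.Prime ∧ q ≠ 2 ∧ q ≠ p ∧ ¬ q ∣ W.conductorNorm ℤ ∧
      ¬ IsSquare ((((-1 : ℤ) ^ (q / 2) * q : ℤ)) : ZMod p) ∧
      ¬ (p : ℤ) ∣ ((q : ℤ) - 1) * (((q : ℤ) + 1) ^ 2 - W.LFunction q ^ 2) := by
  have hp : p.Prime := Fact.out
  haveI : NeZero p := ⟨hp.ne_zero⟩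
  set M' : ℕ := 4 * p with hM'def
  have hM'0 : M' ≠ 0 := mul_ne_zero (by norm_num) hp.ne_zero
  haveI : NeZero M' := ⟨hM'0⟩
  haveI : NeZero (M' : ℚ) := NeZero.charZero
  haveI : NeZero (p : ℚ) := NeZero.charZero
  -- the open normal subgroup `N = ker ρ̄_{E,p} ∩ Gal(ℚ̄/ℚ(μ_{4p}))`
  set N : Subgroup (absoluteGaloisGroup ℚ) := (W.galoisRepTorsion p).ker ⊓ rootsOfUnityFixer ℚ M'
    with hNdef
  have hHn : (rootsOfUnityFixer ℚ M').Normal := by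
    rw [rootsOfUnityFixer_eq_ker]
    exact MonoidHom.normal_ker _
  haveI : N.Normal := Subgroup.normal_inf_normal _ _
  have hNopen : IsOpen (N : Set (absoluteGaloisGroup ℚ)) := by
    rw [hNdef, Subgroup.coe_inf]
    exact (W.isOpen_ker_galoisRepTorsion_holds (n := (p : ℤ)) (by exact_mod_cast hp.ne_zero)).inter
      (isOpen_rootsOfUnityFixer ℚ M')
  -- excluded primes: `p`, bad primes, divisors of `4p`, divisors of the conductor
  have hΔ0 : minimalDiscriminantInt W ≠ 0 := minimalDiscriminantInt_ne_zero W
  have hC0 : W.conductorNorm ℤ ≠ 0 := (W.conductorNorm_pos_holds).ne'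
  set T : Set ℕ := {ℓ | ℓ = p ∨ (ℓ : ℤ) ∣ minimalDiscriminantInt W ∨ ℓ ∣ M' ∨ ℓ ∣ W.conductorNorm ℤ}
    with hTdef
  have hT : T.Finite := by
    refine (Set.finite_le_nat (max p (max (minimalDiscriminantInt W).natAbs
      (max M' (W.conductorNorm ℤ))))).subset ?_
    rintro ℓ (rfl | hℓ | hℓ | hℓ)
    · exact Set.mem_setOf.mpr (le_max_left _ _)
    · exact Set.mem_setOf.mpr (le_max_of_le_right (le_max_of_le_left
        (Nat.le_of_dvd (Int.natAbs_pos.mpr hΔ0) (Int.natCast_dvd.mp hℓ))))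
    · exact Set.mem_setOf.mpr (le_max_of_le_right (le_max_of_le_right (le_max_of_le_left
        (Nat.le_of_dvd (Nat.pos_of_ne_zero hM'0) hℓ))))
    · exact Set.mem_setOf.mpr (le_max_of_le_right (le_max_of_le_right (le_max_of_le_right
        (Nat.le_of_dvd (Nat.pos_of_ne_zero hC0) hℓ))))
  -- Chebotarev
  obtain ⟨v, hvB, -, 𝔓, h𝔓, φ, hφ, hφσ⟩ :=
    exists_isArithFrobAt_mul_inv_mem_not_mem ℚ N hNopen σ _ (finite_setOf_place_over T hT)
  obtain ⟨ℓ, hℓ, hℓv⟩ := exists_prime_natCast_mem v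
  have hℓT : ℓ ∉ T := fun hmem ↦ hvB (Set.mem_biUnion (x := ℓ) ⟨hmem, hℓ.ne_zero⟩ hℓv)
  have hℓp : ℓ ≠ p := fun h ↦ hℓT (Or.inl h)
  have hℓΔ : ¬ (ℓ : ℤ) ∣ minimalDiscriminantInt W := fun h ↦ hℓT (Or.inr (Or.inl h))
  have hℓM' : ¬ ℓ ∣ M' := fun h ↦ hℓT (Or.inr (Or.inr (Or.inl h)))
  have hℓC : ¬ ℓ ∣ W.conductorNorm ℤ := fun h ↦ hℓT (Or.inr (Or.inr (Or.inr h)))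
  have hℓ2 : ℓ ≠ 2 := by
    rintro rfl
    exact hℓM' (Dvd.intro (2 * p) (by rw [hM'def]; ring))
  haveI : Fact ℓ.Prime := ⟨hℓ⟩
  have hgood : W.HasGoodReductionAtPrime ℓ := hasGoodReductionAtPrime_of_not_dvd W ℓ hℓΔ
  -- `φ` acts on `E[p]` as `σ` does, and `χ_{4p}(φ) = χ_{4p}(σ)`
  have hφN : φ * σ⁻¹ ∈ (W.galoisRepTorsion p).ker ∧ φ * σ⁻¹ ∈ rootsOfUnityFixer ℚ M' := by
    have h := hφσ
    rw [hNdef, Subgroup.mem_inf] at h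
    exact h
  have hφE : ∀ P : geomTorsion W p, φ • P = σ • P := by
    intro P
    have h := (NonEisensteinWitness.mem_ker_galoisRepTorsion_iff W p _).mp hφN.1 (σ • P)
    rwa [mul_smul, inv_smul_smul] at h
  have hχeq : modNCyclotomicCharacter ℚ M' φ = modNCyclotomicCharacter ℚ M' σ := by
    have h := hφN.2
    rw [rootsOfUnityFixer_eq_ker, MonoidHom.mem_ker, map_mul, map_inv, mul_inv_eq_one] at h
    exact h
  -- `ℓ ≡ χ_{4p}(σ) (mod 4p)` and `ℓ ≡ χ_p(φ) (mod p)`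
  have hℓv' : ((Rat.HeightOneSpectrum.primesEquiv v : Nat.Primes) : ℕ) = ℓ :=
    primesEquiv_eq_of_natCast_mem hℓ hℓv
  have hres : v.residueCard = ℓ := by
    rw [Rat.residueCard_eq_natGenerator']
    exact hℓv'
  have hM'v : (M' : 𝓞 ℚ) ∉ v.asIdeal :=
    Rat.natCast_not_mem_asIdeal_of_not_dvd (by rw [hℓv']; exact hℓM')
  have hM'𝔓 : (M' : absIntegers (𝓞 ℚ) ℚ) ∉ 𝔓 := natCast_not_mem_of_mem_primesAbove ℚ hM'v h𝔓
  have hχφ : (modNCyclotomicCharacter ℚ M' φ : ZMod M') = (ℓ : ZMod M') := by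
    rw [modNCyclotomicCharacter_eq_residueCard_of_isArithFrobAt h𝔓 hM'𝔓 hφ, hres]
  have hpv : (p : 𝓞 ℚ) ∉ v.asIdeal :=
    Rat.natCast_not_mem_asIdeal_of_not_dvd (by
      rw [hℓv']; intro h; exact hℓp ((Nat.prime_dvd_prime_iff_eq hℓ hp).mp h))
  have hp𝔓 : (p : absIntegers (𝓞 ℚ) ℚ) ∉ 𝔓 := natCast_not_mem_of_mem_primesAbove ℚ hpv h𝔓
  have hχpφ : ((modPCyclotomicCharacterZMod ℚ p φ : (ZMod p)ˣ) : ZMod p) = (ℓ : ZMod p) := by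
    rw [modPCyclotomicCharacterZMod_eq_modNCyclotomicCharacter,
      modNCyclotomicCharacter_eq_residueCard_of_isArithFrobAt h𝔓 hp𝔓 hφ, hres]
  obtain ⟨hnsq, hℓ1⟩ := hσcl ℓ (by rw [← hχφ, hχeq])
  refine ⟨ℓ, hℓ, hℓ2, hℓp, hℓC, hnsq, fun hdvd ↦ ?_⟩
  -- `p ∣ (ℓ - 1)((ℓ + 1)² - a_ℓ²)`: three cases
  have hpZ : Prime (p : ℤ) := Nat.prime_iff_prime_int.mp hp
  have ha : W.LFunction ℓ = W.frobeniusTrace ℓ := LFunction_apply_prime_eq_frobeniusTrace W ℓ hgood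
  rcases hpZ.dvd_or_dvd hdvd with h1 | h1
  · exact hℓ1 h1
  rw [show ((ℓ : ℤ) + 1) ^ 2 - W.LFunction ℓ ^ 2 =
      (W.frobeniusTrace ℓ - (ℓ + 1)) * (-(W.frobeniusTrace ℓ + (ℓ + 1))) by rw [ha]; ring] at h1
  rcases hpZ.dvd_or_dvd h1 with h2 | h2
  · -- `p ∣ #Ẽ(𝔽_ℓ)`: a fixed point of `φ`, hence of `σ`
    have hcnt : p ∣ W.reductionPointCount ℓ := (dvd_frobeniusTrace_sub_iff W p ℓ).mp h2
    obtain ⟨P, hP0, hP⟩ :=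
      exists_frobenius_smul_eq_of_dvd_reductionPointCount_holds W p ℓ hℓp hgood hcnt v hℓv 𝔓 h𝔓 φ hφ
    exact hP0 (hσ1 P (by rw [← hφE P]; exact hP))
  · -- `p ∣ a_ℓ + ℓ + 1`: `(φ + 1)(φ + ℓ) = 0` on `E[p]`, so `φ = -ℓ` on `E[p]` (no eigenvalue `-1`)
    rw [dvd_neg] at h2
    obtain ⟨c, hc⟩ := h2
    have hφeq : ∀ P : geomTorsion W p, φ • (P : geomPoints W) = -((ℓ : ℤ) • (P : geomPoints W)) := by
      intro P
      have hpP' : ((p : ℕ) : ℤ) • (P : geomPoints W) = 0 := (mem_geomTorsion_iff W _ _).mp P.2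
      have hpP : p • (P : geomPoints W) = 0 := by rwa [natCast_zsmul] at hpP'
      have hrel := frobenius_relation_torsion W (p := p) hℓp hgood hℓv h𝔓 hφ (P : geomPoints W) hpP
      -- `a_ℓ • X = -(ℓ + 1) • X` on `p`-torsion `X`
      have haX : ∀ X : geomPoints W, p • X = 0 →
          W.frobeniusTrace ℓ • X = -(((ℓ : ℤ) + 1) • X) := by
        intro X hX
        have hX' : ((p : ℕ) : ℤ) • X = 0 := by rw [natCast_zsmul]; exact hX
        have : W.frobeniusTrace ℓ = c * (p : ℤ) - ((ℓ : ℤ) + 1) := by linear_combination hc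
        rw [this, sub_smul, mul_smul, hX', smul_zero, zero_sub]
      have hpφP : p • (φ • (P : geomPoints W)) = 0 := by
        rw [← smul_comm φ p (P : geomPoints W), hpP, smul_zero]
      rw [haX _ hpφP] at hrel
      -- `Q = φ P + ℓ P` satisfies `φ Q = -Q`
      set Q : geomPoints W := φ • (P : geomPoints W) + (ℓ : ℤ) • (P : geomPoints W) with hQdef
      have hpQ : p • Q = 0 := by
        rw [hQdef, smul_add, hpφP, smul_comm, hpP, smul_zero, add_zero]
      have hφQ : φ • Q = -Q := by
        rw [hQdef, smul_add, smul_comm φ (ℓ : ℤ) (P : geomPoints W)]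
        have e1 : φ • φ • (P : geomPoints W) =
            -(((ℓ : ℤ) + 1) • φ • (P : geomPoints W)) - (ℓ : ℤ) • (P : geomPoints W) := by
          refine sub_eq_zero.mp ?_
          calc φ • φ • (P : geomPoints W) -
                (-(((ℓ : ℤ) + 1) • φ • (P : geomPoints W)) - (ℓ : ℤ) • (P : geomPoints W))
              = φ • φ • (P : geomPoints W) - -(((ℓ : ℤ) + 1) • φ • (P : geomPoints W)) +
                  (ℓ : ℤ) • (P : geomPoints W) := by abel
            _ = 0 := hrel
        rw [e1, add_smul, one_smul]
        abel
      have hQ' : (⟨Q, (mem_geomTorsion_iff W _ _).mpr (by rw [natCast_zsmul]; exact hpQ)⟩ :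
          geomTorsion W p) = 0 := by
        refine hσ2 _ ?_
        rw [← hφE]
        apply Subtype.ext
        rw [AddSubgroup.torsionBy.coe_smul, NegMemClass.coe_neg]
        exact hφQ
      have hQ0 : Q = 0 := congrArg Subtype.val hQ'
      rw [hQdef, add_eq_zero_iff_eq_neg] at hQ0
      exact hQ0
    -- a frame and the matrix of `φ`: it is the scalar `-ℓ`, so `det = ℓ²`
    obtain ⟨P₁, hP₁0⟩ := exists_geomTorsion_ne_zero W p
    obtain ⟨e, -⟩ := exists_addEquiv_apply_eq_single W p hP₁0
    obtain ⟨M, hM⟩ := NonEisensteinWitness.exists_matrix_frame W p e φ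
    have hMv : ∀ x : Fin 2 → ZMod p, M.mulVec x = (-(ℓ : ZMod p)) • x := by
      intro x
      obtain ⟨T, rfl⟩ := e.surjective x
      rw [← hM T]
      have hT : φ • T = -((ℓ : ℤ) • T) := by
        apply Subtype.ext
        rw [AddSubgroup.torsionBy.coe_smul, hφeq T, NegMemClass.coe_neg, AddSubgroupClass.coe_zsmul]
      rw [hT, map_neg, map_zsmul, neg_smul, ← Int.cast_smul_eq_zsmul (ZMod p), Int.cast_natCast]
    have hMij : ∀ i j : Fin 2, M i j = (-(ℓ : ZMod p)) * (Pi.single j (1 : ZMod p) : Fin 2 → ZMod p) i := by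
      intro i j
      have h := congrFun (hMv (Pi.single j 1)) i
      rw [Matrix.mulVec_single_one, Matrix.col_apply, Pi.smul_apply, smul_eq_mul] at h
      exact h
    have hdet : M.det = (ℓ : ZMod p) ^ 2 := by
      rw [Matrix.det_fin_two, hMij 0 0, hMij 1 1, hMij 0 1, hMij 1 0,
        Pi.single_eq_same, Pi.single_eq_same, Pi.single_eq_of_ne (by decide : (0 : Fin 2) ≠ 1),
        Pi.single_eq_of_ne (by decide : (1 : Fin 2) ≠ 0)]
      ring
    have hdet' := det_eq_modPCyclotomicCharacterZMod_of_exists_weilPairing W p (exists_weilPairing_holds W p)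
      e φ M hM
    rw [hdet, hχpφ, sq] at hdet'
    -- `ℓ² = ℓ` in `𝔽_p`: `ℓ ≡ 0` or `ℓ ≡ 1`
    have hℓ0 : (ℓ : ZMod p) ≠ 0 := by
      rw [Ne, ZMod.natCast_eq_zero_iff]
      intro h; exact hℓp ((Nat.prime_dvd_prime_iff_eq hp hℓ).mp h).symm
    have hℓ1' : (ℓ : ZMod p) = 1 := by
      have : (ℓ : ZMod p) * ((ℓ : ZMod p) - 1) = 0 := by rw [mul_sub, mul_one, hdet', sub_self]
      rcases mul_eq_zero.mp this with h | h
      · exact absurd h hℓ0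
      · exact sub_eq_zero.mp h
    apply hℓ1
    have : ((ℓ : ℤ) : ZMod p) = ((1 : ℤ) : ZMod p) := by push_cast; exact hℓ1'
    rw [← ZMod.intCast_zmod_eq_zero_iff_dvd, Int.cast_sub, this]
    push_cast; ring

/-- **The TRANSFER WITNESS `hW″` from the Galois side.** If for every globally minimal `V₀/ℚ` additive at
`p ∈ {5, 7}` with `E[p]` irreducible some `σ ∈ Γ_ℚ` has `χ_{4p}(σ)` in a good class (every
`ℓ ≡ χ_{4p}(σ) (mod 4p)` has `ℓ*` a non-residue mod `p` and `ℓ ≢ 1 (mod p)`) and `ρ̄_{E,p}(σ)` without eigenvalue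
`±1`, then the hypothesis `hW` of `LTwistTransfer.twistDegreeStepFiveSeven_of_kato_of_transferWitness` (and of the
KP57 / AKR #7 siblings) holds VERBATIM. The remaining input of the Ihara-free chain is thus a statement about the
image of `ρ̄_{E,p}` in `GL₂(𝔽_p) × (ℤ/4p)^×` (finite group theory). [cite: TateGCFT1967, §2.4]
[cite: SilvermanAEC2009, V.2.3.1, VII.3.1(b)] -/
theorem transferWitness_of_galois
    (hG : ∀ (p : ℕ) [Fact p.Prime] (V₀ : WeierstrassCurve ℚ) [V₀.IsElliptic] [V₀.IsGloballyMinimal],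
      (p = 5 ∨ p = 7) → Addv V₀ p → Irr V₀ p →
      ∃ σ : absoluteGaloisGroup ℚ,
        (∀ ℓ : ℕ, ((ℓ : ZMod (4 * p)) = (modNCyclotomicCharacter ℚ (4 * p) σ : ZMod (4 * p))) →
          ¬ IsSquare ((((-1 : ℤ) ^ (ℓ / 2) * ℓ : ℤ)) : ZMod p) ∧ ¬ (p : ℤ) ∣ (ℓ : ℤ) - 1) ∧
        (∀ P : geomTorsion V₀ p, σ • P = P → P = 0) ∧
        (∀ P : geomTorsion V₀ p, σ • P = -P → P = 0)) :
    ∀ (p : ℕ) [Fact p.Prime] (V₀ : WeierstrassCurve ℚ) [V₀.IsElliptic] [V₀.IsGloballyMinimal],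
      (p = 5 ∨ p = 7) → Addv V₀ p → Irr V₀ p →
      ∃ q : ℕ, q.Prime ∧ q ≠ 2 ∧ q ≠ p ∧ ¬ q ∣ V₀.conductorNorm ℤ ∧
        ¬ IsSquare ((((-1 : ℤ) ^ (q / 2) * q : ℤ)) : ZMod p) ∧
        ¬ (p : ℤ) ∣ ((q : ℤ) - 1) * (((q : ℤ) + 1) ^ 2 - V₀.LFunction q ^ 2) := by
  intro p _ V₀ _ _ hp57 hadd hirr
  obtain ⟨σ, hσcl, hσ1, hσ2⟩ := hG p V₀ hp57 hadd hirr
  exact exists_transferPrime_of_galois V₀ p hσcl hσ1 hσ2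

end Summit.BirchSwinnertonDyer.BirchSwinnertonDyer.Theorems.LTwistTransfer

end
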